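/-
Copyright (c) 2026 the pub-hodgecm-mathlib formalisation cell (harness21).  Prover seat hodgecm-mathlib-LH4-p10 (g10), req620 Track A «(D-RAM) FOUR-FRAME» squad
((β₂) road (R-36) «PURE-CELL LEDGER», lane C = type RamM, β₂ WORD #45 «held: ‹HL_RAY_C♭› LH4-p10 (g10) worker + LH4-p19 (g4) kit»: the DIAGONAL parity branch of the
lane-C LOWER line is vacuous), helper lane on h413 = stmt-HodgeConjecture-24833 (count-neutral).  2026-09-05.
-/
import Summits.HodgeConjecture.HodgeConjecture.Theorems.F0P3cDyRamUpperLineCellCentre     -- ★ F3 (LH7-p10 lineage): `exists_centre_coord`, `map_centre_coord_sub`, `map_centre_sub_centre`, `v_centre_eq`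
import Literature.NumberTheory.LocalFields.WildQuadraticEisensteinFrame                     -- ★ Lit: `exists_fixed_coords_of_map_ne` (Eisenstein coordinates `z = a + b·ϖ`)
import HarnessLib

/-!
# Crux `H413`, line LH4 «(D-RAM) FOUR-FRAME» — the (β₂) road (R-36), (OFF_C) residue, lane C (type RamM): «THE DIAGONAL BRANCH OF THE LOWER LINE IS VACUOUS» — on the
# lane-C lower line `jl = 2j + d_ρ + 2b + 2ℓ₀` the parity letter's diagonal disjunct `j + 1 = b + s0` contradicts the element's own parity invariant `jl_E ≡ s0 + d (mod 2)`

Cell `hodgecm-mathlib` (D-0151), FLOOR 0, crux item H413 = `stmt-HodgeConjecture-24833`, route of record `HCCMUnconditional`; squads F0∕P3c∕LH4 ∕ LH7; lane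
`--supports stmt-HodgeConjecture-24833 --as helper` (count-neutral; pays NO tier-0 row).  THEOREMS ONLY (no `def`, no instance, no notation, no `sorry`, default heartbeats);
★-only imports; states NO law; (β₂) stays a HYPOTHESIS.  SCALARS ONLY: the line model (`Θlam·lam = 1`, `u·σu = 1`, `|u| = 1`), the `jE`-letters of ‹OFF_C.letter.v2›
(`Fix ρ = jE(E)`, `Θ∘jE = jE∘σ`, `ρ∘jE = jE`, `_hjpow`, `_c1 : |jE a| = |a|²`), the E-datum `IsRamifiedQuadraticDatum σ ϖ d tE`, the multiplier tokens `|μ| = exp(−m)`,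
`|μ − ρμ| = exp(−jl)`, a reference pair `κ₀, ξ₀` at `|ξ₀| = exp(2d′ + 4·0)` (★ G1 `exists_refPair_ramM … 0`), `m = 2m_E` (★ `depth_even_of_letters_ramM`), the LOWER LINE
`jl = 2j + d_ρ + 2b + 2(d % 2)`, `2d′ = d_ρ + 2s0` (`_c22 _c29`), and the DIAGONAL letter `j + 1 = b + s0`.

WHY (split LH4-p19 (g4) KIT ∕ LH4-p10 (g10) WORKER on ‹HL_RAY_C♭› = ★ C4 `…OffRowCLowerShellFold.offRowCL_of_shellFree_bands`'s binder `hR`, whose cell tail carries the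
parity letter `(j + 1 = b + s0 ∨ (b + s0 ≤ j ∧ (j − b − s0) % 2 = 0))`).  On the TOP line both disjuncts are live (★ G7 p865146 ∕ ★ G8 p865410); on the LOWER line the diagonal
one is EMPTY OF ELEMENTS: the centre `κ_c = ρμ∕(ρμ − μ)` has a coordinate `W ∈ E` with `jE W·ξ₀ = κ_c − κ₀` (★ F3 `exists_centre_coord`), and `jE(W − σW)·ξ₀ = κ_c − Θκ_c =
−κ_c·μ∕jE u` (★ F3 `map_centre_coord_sub` ∕ `map_centre_sub_centre`), so `|jE(W − σW)| = |μ|²∕(|μ − ρμ|·|ξ₀|) = exp(jl − 2m − 2d′)`; on the lower line with `j + 1 = b + s0`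
this is `|jEϖ|^{2m_E − 2b − ℓ₀ + 1}`, i.e. `|W − σW| = |ϖ|^{2m_E − 2b − ℓ₀ + 1}` (`_hjpow`) — exponent of parity `ℓ₀ + 1`.  But `W = a + c·ϖ` with `a, c` `σ`-fixed (★ Lit
`exists_fixed_coords_of_map_ne`), `W − σW = c·(ϖ − σϖ)`, `c ≠ 0` (else `κ_c·μ = 0`), `|c| = exp(2t)` (fixed elements have even order), `|ϖ − σϖ| = |ϖ|^d`: `|W − σW| =
exp(2t − d)` — exponent of parity `d ≡ ℓ₀`.  Contradiction (`omega`).  CONSEQUENCE for the leaf: ‹HL_RAY_C♭› = its GENERIC branch (the worker `…OffRowCLowerRayWorker`,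
this seat, KIT ★ p865492 + KIT-2/3 LH4-p19 (g4)) + this lemma + a two-line `rcases` glue — NO diagonal worker, NO primed kit.
* HEAD `false_of_lowerLine_diag_ramM` — the hypotheses above ⟹ `False`.
HONEST LABEL.  Count-neutral valuation algebra; nothing printed is asserted; no census law is stated; ‹HL_RAY_C♭› and (β₂) `stub_law_cleanSgn₂` stay OPEN; `HC_CM` is proved only
modulo the 7 printed citations (2 remaining named inputs: hLiu418 = `stmt-HodgeConjecture-24832`, h413 = `stmt-HodgeConjecture-24833`) until rung 0 closes.
## References
* [Serre1979] J.-P. Serre, *Local Fields*, GTM 67 (1979): Ch. I §6 Prop. 18 (Eisenstein coordinates), Ch. III §6 Prop. 12, Ch. V §3 (even order of fixed elements).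
* [Rogawski1990] J. D. Rogawski, *Automorphic Representations of Unitary Groups in Three Variables*, Ann. of Math. Stud. 123 (1990): §4.9 Prop. 4.9.1 (b) p. 55 (the line model).
* [Kottwitz1986BaseChangeUnits] R. E. Kottwitz, *Base change for unit elements of Hecke algebras*, Compositio Math. 60 (1986): §1 pp. 240–241 (the cells).
-/

set_option autoImplicit false

noncomputable section

namespace Summit.HodgeConjecture.HodgeConjecture.Cruxes.H413.F0P3cDyRamLowerLineDiagVacuousRamM

open scoped Valued WithZero
open WithZero
open Literature.NumberTheory.Automorphic.UnitaryThreeFourFrame (IsRamifiedQuadraticDatum)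
open Literature.NumberTheory.LocalFields (exists_fixed_coords_of_map_ne)
open Summit.HodgeConjecture.HodgeConjecture.Cruxes.H413.F0P3cDyRamUpperLineCellCentre (v_centre_eq exists_centre_coord map_centre_coord_sub map_centre_sub_centre)

variable {E M : Type} [Field E] [Valued E ℤᵐ⁰] [Field M] [Valued M ℤᵐ⁰] {ρ Θ : M →+* M}

/-- **HEAD — «THE DIAGONAL BRANCH OF THE LANE-C LOWER LINE IS VACUOUS».**  For the lane-C line model (`Θlam·lam = 1`, `u·σu = 1`, `|u| = 1`, `|jE a| = |a|²`,
`Fix ρ = jE(E)`, `Θ∘jE = jE∘σ`, `ρ∘jE = jE`, the E-datum), the multiplier `μ = lam − jE u` with `|μ| = exp(−m)`, `|μ − ρμ| = exp(−jl)`, `m = 2m_E`, a reference pair `κ₀`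
(`Tr_ρ κ₀ = 1`, `Θκ₀ = κ₀`), `ξ₀` (`ρξ₀ = −ξ₀`, `Θξ₀ = ξ₀ ≠ 0`, `|ξ₀| = exp(2d′ + 4·0)`), the lower line `jl = 2j + d_ρ + 2b + 2(d % 2)` (`2d′ = d_ρ + 2s0`) and the
DIAGONAL parity letter `j + 1 = b + s0` are contradictory: the centre's coordinate `W` (`jE W·ξ₀ = κ_c − κ₀`) has `jE(W − σW)·ξ₀ = κ_c − Θκ_c = −κ_c·μ∕jE u`, whence
`|W − σW| = |ϖ|^{2m_E − 2b − ℓ₀ + 1}` (parity `ℓ₀ + 1`); but `W − σW = c·(ϖ − σϖ)` with `c ≠ 0` `σ`-fixed, so `|W − σW| = exp(2t − d)` (parity `d ≡ ℓ₀`).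
[cite: Serre1979, Ch. I §6 Prop. 18; Ch. III §6 Prop. 12; Ch. V §3] [cite: Rogawski1990, §4.9 Prop. 4.9.1 (b) p. 55] [cite: Kottwitz1986BaseChangeUnits, §1 pp. 240–241] -/
theorem false_of_lowerLine_diag_ramM {σ : E →+* E} {ϖ : E} {d tE : ℕ} (hD : IsRamifiedQuadraticDatum σ ϖ d tE)
    (jE : E →+* M) (hjfix : ∀ z, ρ z = z ↔ ∃ c, jE c = z) (hΘj : ∀ c, Θ (jE c) = jE (σ c)) (hρj : ∀ c, ρ (jE c) = jE c)
    (hjpow : ∀ (t : E) (n : ℤ), Valued.v (jE t) = Valued.v (jE ϖ) ^ n ↔ Valued.v t = Valued.v ϖ ^ n)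
    (c1 : ∀ a, Valued.v (jE a) = Valued.v a ^ 2)
    (hρρ : ∀ x, ρ (ρ x) = x) (hvρ : ∀ x, Valued.v (ρ x) = Valued.v x) (hΘρ : ∀ x, Θ (ρ x) = ρ (Θ x))
    {lam : M} (hΘlam : Θ lam * lam = 1) {u : E} (huu : u * σ u = 1) (hu : Valued.v u = 1)
    {m jl : ℕ} (hm : Valued.v (lam - jE u) = exp (-(m : ℤ))) (hjl : Valued.v ((lam - jE u) - ρ (lam - jE u)) = exp (-(jl : ℤ)))
    {κ₀ ξ₀ : M} (hκ₀ : κ₀ + ρ κ₀ = 1) (hΘκ₀ : Θ κ₀ = κ₀) (hξ : ρ ξ₀ = -ξ₀) (hΘξ : Θ ξ₀ = ξ₀) (hξ0 : ξ₀ ≠ 0)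
    {d' : ℕ} (hξv : Valued.v ξ₀ = exp (2 * (d' : ℤ) + 4 * ((0 : ℕ) : ℤ)))
    {mE j b dρ s0 : ℕ} (hmE : m = 2 * mE) (hline : jl = 2 * j + dρ + 2 * b + 2 * (d % 2)) (hds : 2 * d' = dρ + 2 * s0) (hdiag : j + 1 = b + s0) :
    False := by
  obtain ⟨hσ, hvσ, hϖ, hfixE, hd, hd1, -⟩ := id hD
  have hvϖ0 : Valued.v ϖ ≠ 0 := (by rw [hϖ]; exact exp_ne_zero); have hϖ0 : ϖ ≠ 0 := fun h0 => hvϖ0 (by rw [h0, map_zero])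
  have hϖσ : σ ϖ ≠ ϖ := fun h0 => by
    have h1 := hd
    rw [h0, sub_self, map_zero] at h1
    exact pow_ne_zero _ hvϖ0 h1.symm
  have hjϖ : Valued.v (jE ϖ) = exp (-2 : ℤ) := by rw [c1, hϖ, ← exp_nsmul]; congr 1
  have hju : Valued.v (jE u) = 1 := by rw [c1, hu, one_pow]
  have hu0 : u ≠ 0 := fun h0 => by rw [h0, zero_mul] at huu; exact zero_ne_one huu
  have hju0 : jE u ≠ 0 := (map_ne_zero jE).2 hu0
  have hμρ : ρ (lam - jE u) ≠ lam - jE u := fun h0 => by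
    have h1 := hjl
    rw [h0, sub_self, map_zero] at h1; exact exp_ne_zero h1.symm
  have hμ0 : lam - jE u ≠ 0 := fun h0 => by rw [h0, map_zero] at hm; exact exp_ne_zero hm.symm
  have hρμ0 : ρ (lam - jE u) ≠ 0 := (map_ne_zero ρ).2 hμ0
  have hden : ρ (lam - jE u) - (lam - jE u) ≠ 0 := sub_ne_zero.2 hμρ
  have hκc0 : ρ (lam - jE u) / (ρ (lam - jE u) - (lam - jE u)) ≠ 0 := div_ne_zero hρμ0 hden
  -- the centre's coordinate `W` and its fixed defect (★ F3)
  obtain ⟨W, hW⟩ := exists_centre_coord jE hjfix hρρ hμρ hκ₀ hξ hξ0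
  have h1 := map_centre_coord_sub σ jE hΘj hΘκ₀ hΘξ hW
  have h2 := map_centre_sub_centre σ jE hΘj hρj hΘρ hΘlam huu hμρ
  have h3 : jE (W - σ W) = -(ρ (lam - jE u) / (ρ (lam - jE u) - (lam - jE u)) * ((lam - jE u) / jE u)) / ξ₀ := by
    rw [eq_div_iff hξ0, h1, ← h2]; ring
  have hne : jE (W - σ W) ≠ 0 := by
    rw [h3]; exact div_ne_zero (neg_ne_zero.2 (mul_ne_zero hκc0 (div_ne_zero hμ0 hju0))) hξ0
  have hvκ := v_centre_eq hvρ (lam - jE u)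
  have hvW : Valued.v (jE (W - σ W)) = Valued.v (jE ϖ) ^ (2 * (mE : ℤ) - 2 * b - (d % 2 : ℕ) + 1) := by
    rw [h3, map_div₀, Valuation.map_neg, Valuation.map_mul, hvκ, map_div₀ _ (lam - jE u) (jE u), hm, hjl, hju, hξv, hjϖ, div_one,
      ← exp_sub, ← exp_add, ← exp_sub, ← exp_zsmul, smul_eq_mul]
    congr 1; push_cast; omega
  have hWE : Valued.v (W - σ W) = Valued.v ϖ ^ (2 * (mE : ℤ) - 2 * b - (d % 2 : ℕ) + 1) := (hjpow _ _).1 hvW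
  -- Eisenstein coordinates: `W − σW = c·(ϖ − σϖ)` with `c` fixed, so `|W − σW| ∈ exp(2ℤ)·|ϖ|^d ∪ {0}`
  obtain ⟨a, c, ha, hc, hWac⟩ := exists_fixed_coords_of_map_ne hσ hϖσ W
  have hskew : W - σ W = c * (ϖ - σ ϖ) := by rw [hWac, map_add, map_mul, ha, hc]; ring
  rcases eq_or_ne c 0 with hc0 | hc0
  · exact hne (by rw [hskew, hc0, zero_mul, map_zero])
  · obtain ⟨t, ht⟩ := hfixE c hc hc0
    have hE2 : Valued.v (W - σ W) = exp (2 * t - (d : ℤ)) := by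
      rw [hskew, Valuation.map_mul, ht, hd, hϖ, ← exp_nsmul, ← exp_add]; congr 1; simp only [nsmul_eq_mul]; ring
    have key := hWE.symm.trans hE2
    rw [hϖ, ← exp_zsmul, smul_eq_mul, exp_inj] at key
    push_cast at key
    omega

end Summit.HodgeConjecture.HodgeConjecture.Cruxes.H413.F0P3cDyRamLowerLineDiagVacuousRamM

end
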